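import Literature.AlgebraicGeometry.Modules.SheafifyTorsionFree
import Literature.AlgebraicGeometry.Crystalline.DeRhamComplexSheaf
import Literature.AlgebraicGeometry.Crystalline.HodgeSheavesTorsionFree
import HarnessLib

/-!
# All terms `Ωʲ_{𝒳/W}` of the algebraic de Rham complex of a smooth `W(k)`-scheme have no `p`-torsion

For a scheme `X` SMOOTH of relative dimension `d` over `Spec A` and an integer `q` such that no
`Γ(X, U)` has `q`-torsion (e.g. `(q : A)` regular, `X → Spec A` being flat), multiplication by `q`
is a MONOMORPHISM of every term `(algebraicDeRhamComplex X).X j = (⋀ʲ Ω¹)♯` of the algebraic de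
Rham complex of sheaves (`Crystalline/DeRhamComplexSheaf`), for ALL degrees `j`
(`mono_zsmul_id_algebraicDeRhamComplex_X`):

* `exists_standardSmooth_chart_le` — every point has arbitrarily small affine open neighbourhoods
  `V` on which the structure map `A → Γ(X, V)` is standard smooth of relative dimension `d` (the
  ring-hom property `Locally (IsStandardSmoothOfRelativeDimension d)` of
  `SmoothOfRelativeDimension d`, as in `Motives/HodgeSheavesProofs.exists_basis_sections_cotangentSheaf`,
  run inside a prescribed open);
* `formsPresheaf_eq_zero_of_zsmul_eq_zero_of_chart` — on such a chart the presheaf sections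
  `⋀ʲ_{Γ(V)} Ω[Γ(V)⁄A]` are a FREE `Γ(X, V)`-module (Mathlib: `IsStandardSmooth.free_kaehlerDifferential`,
  `exteriorPower.instFree`), hence have no `q`-torsion when `Γ(X, V)` has none (coordinates in a
  basis);
* whence the sheafification argument `Modules/SheafifyTorsionFree.mono_zsmul_id_sheafify_of_locally`.

The `p`-adic case (`mono_p_smul_id_algebraicDeRhamComplex_X`, and the `IsSmoothProperModel`
wrapper): for `𝒳/W(k)` smooth, `p • 𝟙 Ωʲ` is mono for every `j` — "`Ωʲ_𝒳` is `p`-torsion free"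
(X. Hu, arXiv:2507.12458, Def. 8.2), the hypothesis `Mono ((q : ℤ) • 𝟙 T)` of the term
identification `p^{a}(Ωʲ/p^{c}) ≅ Ωʲ/p^{c-a}` (`Algebra/Homology/StaircaseTorsionFree`) for the terms
of X. Hu's complexes `Crystalline/HuComplexes.huComplex 𝒳 p r M N`, in every degree (degrees
`j ≥ 2` occur for `r ≥ 3`, e.g. on the kernel side `ℍ^{2r-1}` for `d = 3`). [folklore]
Everything is proved; no named facts.
-/

noncomputable section

namespace Literature.AlgebraicGeometry.Crystalline

open CategoryTheory CategoryTheory.Limits _root_.AlgebraicGeometry _root_.TopologicalSpace Opposite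
open Literature.AlgebraicGeometry.Motives Literature.AlgebraicGeometry.Modules

universe u

/-! ## 1. Standard-smooth charts form a neighbourhood basis -/

section Charts

-- `TopCat.Presheaf`/`TopCat.Sheaf` are not reducible: as in Mathlib's `AlgebraicGeometry.Modules`.
set_option backward.isDefEq.respectTransparency false

variable {A : Type u} [CommRing A] (X : Over (Spec (CommRingCat.of A))) (d : ℕ)
  [SmoothOfRelativeDimension d X.hom]

include d

/-- **Standard-smooth charts are a neighbourhood basis.** On a scheme smooth of relative dimension
`d` over `Spec A`, every point `x` of an open `U` has an affine open neighbourhood `V ≤ U` on which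
the structure map `A → Γ(X, V)` is standard smooth of relative dimension `d` (inside an affine open
`U' ∋ x`, `U' ⊆ U`, the map `A → Γ(X, U')` is locally standard smooth, i.e. standard smooth on
`Γ(X, D(t))` for `t` in a set generating the unit ideal; take `D(t) ∋ x`).
[cite: StacksProject, Tag 00T7] -/
theorem exists_standardSmooth_chart_le {U : X.left.Opens} {x : X.left} (hx : x ∈ U) :
    ∃ V : X.left.Opens, IsAffineOpen V ∧ x ∈ V ∧ V ≤ U ∧
      ((constToPresheaf X).app (op V)).hom.IsStandardSmoothOfRelativeDimension d := by
  obtain ⟨U', hU', hxU', hU'U⟩ := exists_isAffineOpen_mem_and_subset hx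
  have hloc := HasRingHomProperty.appLE (@SmoothOfRelativeDimension d) X.hom ‹_›
    ⟨⊤, isAffineOpen_top _⟩ ⟨U', hU'⟩ le_top
  obtain ⟨s, hs, hst⟩ := (RingHom.locally_iff_isLocalization
    RingHom.isStandardSmoothOfRelativeDimension_respectsIso _).mp hloc
  obtain ⟨⟨t, ht⟩, hxt⟩ := Opens.mem_iSup.mp
    (hU'.self_le_iSup_basicOpen_iff.mpr (by exact_mod_cast hs) hxU')
  have hle : X.left.basicOpen t ≤ U := fun y hy => hU'U (X.left.basicOpen_le t hy)
  refine ⟨X.left.basicOpen t, hU'.basicOpen t, hxt, hle, ?_⟩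
  haveI : Nonempty (X.left.basicOpen t) := ⟨⟨x, hxt⟩⟩
  haveI := hU'.isLocalization_basicOpen t
  have hfg : ((constToPresheaf X).app (op (X.left.basicOpen t))).hom =
      (algebraMap Γ(X.left, U') Γ(X.left, X.left.basicOpen t)).comp
        ((constToPresheaf X).app (op U')).hom := by
    ext r
    have h := CategoryTheory.congr_fun
      ((constToPresheaf X).naturality (homOfLE (X.left.basicOpen_le t)).op) r
    simp only [Functor.const_obj_map, CommRingCat.comp_apply] at h
    exact h
  have h1 : ((constToPresheaf X).app (op U')).hom = (X.hom.appLE ⊤ U' le_top).hom.comp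
      (Scheme.ΓSpecIso (CommRingCat.of A)).commRingCatIsoToRingEquiv.symm.toRingHom :=
    RingHom.ext fun r => rfl
  rw [hfg, h1, ← RingHom.comp_assoc]
  exact RingHom.isStandardSmoothOfRelativeDimension_respectsIso.2 _ _
    (hst t ht Γ(X.left, X.left.basicOpen t))

end Charts

/-! ## 2. Forms on a chart have no more torsion than the functions -/

section Forms

variable {A : Type u} [CommRing A] (X : Over (Spec (CommRingCat.of A))) (d : ℕ)

/-- **On a standard-smooth chart the `j`-forms are free, hence no more `q`-torsion than `𝒪`.** If
`A → Γ(X, V)` is standard smooth of relative dimension `d`, the presheaf sections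
`⋀ʲ_{Γ(V)} Ω[Γ(X,V)⁄A]` of the de Rham presheaf are a free `Γ(X, V)`-module (Mathlib
`IsStandardSmooth.free_kaehlerDifferential`, `exteriorPower.instFree`); so if `Γ(X, V)` has no
`q`-torsion, neither have they (coordinates in a basis). [cite: StacksProject, Tag 00T7] -/
theorem formsPresheaf_eq_zero_of_zsmul_eq_zero_of_chart {V : X.left.Opens}
    (h : ((constToPresheaf X).app (op V)).hom.IsStandardSmoothOfRelativeDimension d) (q : ℤ)
    (hq : ∀ a : Γ(X.left, V), q • a = 0 → a = 0) (j : ℕ)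
    (s : (DeRhamComplexPresheaf.formsPresheaf (constToPresheaf X) j).obj (op V))
    (hs : q • s = 0) : s = 0 := by
  letI algV : Algebra A Γ(X.left, V) := (((constToPresheaf X).app (op V)).hom).toAlgebra
  haveI : Algebra.IsStandardSmoothOfRelativeDimension d A Γ(X.left, V) := h
  haveI : Algebra.IsStandardSmooth A Γ(X.left, V) :=
    Algebra.IsStandardSmoothOfRelativeDimension.isStandardSmooth d
  haveI : Module.Free Γ(X.left, V) Ω[Γ(X.left, V)⁄A] := inferInstance
  -- the sections are the `j`-th exterior power, a free module; use coordinates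
  change (⋀[Γ(X.left, V)]^j Ω[Γ(X.left, V)⁄A] : Type u) at s
  let b := Module.Free.chooseBasis Γ(X.left, V) (⋀[Γ(X.left, V)]^j Ω[Γ(X.left, V)⁄A])
  have hcoord : ∀ i, b.repr s i = 0 := fun i => by
    apply hq
    have h1 := congrArg (fun v => v i) (map_zsmul b.repr q s)
    simp only [Finsupp.smul_apply] at h1
    rw [← h1]
    change b.repr (q • s) i = 0
    rw [show (q • s : ⋀[Γ(X.left, V)]^j Ω[Γ(X.left, V)⁄A]) = 0 from hs, map_zero,
      Finsupp.zero_apply]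
  have hrepr : b.repr s = 0 := Finsupp.ext hcoord
  exact b.repr.map_eq_zero_iff.1 hrepr

end Forms

/-! ## 3. The terms of the de Rham complex of sheaves -/

section Terms

variable {A : Type u} [CommRing A] (X : Over (Spec (CommRingCat.of A))) (d : ℕ)
  [SmoothOfRelativeDimension d X.hom]

include d

/-- **`q • 𝟙 Ωʲ` is mono, all `j`.** For `X` smooth of relative dimension `d` over `Spec A` and an
integer `q` such that no `Γ(X, U)` has `q`-torsion, multiplication by `q` is a monomorphism of the
`j`-th term `(⋀ʲ Ω¹)♯` of `algebraicDeRhamComplex X` (the sheafification argument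
`mono_zsmul_id_sheafify_of_locally` over the standard-smooth charts). [cite: StacksProject, Tag 00T7] -/
theorem mono_zsmul_id_algebraicDeRhamComplex_X (q : ℤ)
    (hq : ∀ (U : X.left.Opens) (a : Γ(X.left, U)), q • a = 0 → a = 0) (j : ℕ) :
    Mono (q • 𝟙 ((algebraicDeRhamComplex X).X j)) := by
  change Mono (q • 𝟙 ((presheafToSheaf (Opens.grothendieckTopology X.left) AddCommGrpCat.{u}).obj
    (DeRhamComplexPresheaf.formsPresheaf (constToPresheaf X) j)))
  apply mono_zsmul_id_sheafify_of_locally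
  intro U x hx
  obtain ⟨V, -, hxV, hVU, hchart⟩ := exists_standardSmooth_chart_le X d hx
  exact ⟨V, hxV, hVU, fun s hs =>
    formsPresheaf_eq_zero_of_zsmul_eq_zero_of_chart X d hchart q (hq V) j s hs⟩

/-- The same from flatness of the base: for `X → Spec A` smooth of relative dimension `d` (hence
flat) and `(q : A)` regular, `q • 𝟙 Ωʲ` is mono for every `j`. [cite: StacksProject, Tag 00HI] -/
theorem mono_zsmul_id_algebraicDeRhamComplex_X_of_isRegular (q : ℤ) (hqA : IsRegular (q : A))
    (j : ℕ) : Mono (q • 𝟙 ((algebraicDeRhamComplex X).X j)) := by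
  haveI : Smooth X.hom := SmoothOfRelativeDimension.smooth d X.hom
  exact mono_zsmul_id_algebraicDeRhamComplex_X X d q
    (fun U a ha => eq_zero_of_zsmul_eq_zero X.hom q hqA U a ha) j

end Terms

/-! ## 4. Smooth `W(k)`-schemes -/

section Witt

variable {p : ℕ} [Fact p.Prime] {k : Type u} [Field k] [CharP k p]
  (𝒳 : SchemeOver (WittVector p k)) (d : ℕ) [SmoothOfRelativeDimension d 𝒳.hom]

include d

/-- **`p • 𝟙 Ωʲ_{𝒳/W}` is mono for every `j`** (`𝒳/W(k)` smooth): every term of the algebraic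
de Rham complex of sheaves of `𝒳`, hence of the complexes `deRhamReduction` / `huComplex` of
`Crystalline/HuComplexes` built from it by cokernels and images of powers of `p`, starts from a
`p`-torsion-free sheaf — "`Ωʲ_𝒳` is `p`-torsion free" (X. Hu, arXiv:2507.12458, Def. 8.2).
[cite: StacksProject, Tag 00T7] -/
theorem mono_p_smul_id_algebraicDeRhamComplex_X (j : ℕ) :
    Mono ((p : ℤ) • 𝟙 ((algebraicDeRhamComplex 𝒳).X j)) :=
  mono_zsmul_id_algebraicDeRhamComplex_X_of_isRegular 𝒳 d (p : ℤ)
    (WittVector.isRegular_intCast_p p k) j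

omit [SmoothOfRelativeDimension d 𝒳.hom] in
/-- The `IsSmoothProperModel` wrapper: for a smooth proper model `𝒳/W(k)`, `p • 𝟙` is mono on
every term of `algebraicDeRhamComplex 𝒳`. [cite: StacksProject, Tag 00T7] -/
theorem _root_.Literature.AlgebraicGeometry.Motives.WittScheme.IsSmoothProperModel.mono_p_smul_id_algebraicDeRhamComplex_X
    (h𝒳 : WittScheme.IsSmoothProperModel d 𝒳) (j : ℕ) :
    Mono ((p : ℤ) • 𝟙 ((algebraicDeRhamComplex 𝒳).X j)) := by
  haveI := h𝒳.smoothOfRelativeDimension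
  exact Literature.AlgebraicGeometry.Crystalline.mono_p_smul_id_algebraicDeRhamComplex_X 𝒳 d j

end Witt

end Literature.AlgebraicGeometry.Crystalline
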